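import Mathlib.Analysis.SpecialFunctions.Pow.Real
import Mathlib.Data.Nat.Choose.Central
import Literature.Computability.AlgebraicComplexity.DeterminantalComplexityProofs
import Summits.ValiantsHypothesis.ValiantsHypothesis.Theorems.DetQPDetqpThesisStubGrenetRowPartitioned

/-!
# `DetqpThesis` (stmt-ValiantsHypothesis-0315), line `fat-row-recursion` — calibration of the bet
# S3 from ABOVE: eventual Grenet-tightness ⇒ fat blocks for every `ε < 1/2`

A ROW-PARTITIONED affine determinantal representation of `per_n = perPoly (Fin n) ℂ` of size `M`
is an affine determinantal representation `A` (`IsAffineDetRepr`) together with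
`β : Fin M → Fin n` such that matrix row `a` reads only the variables `X (•, β a)`; block `c` is
`{a | β a = c}`.  The line's bet S3 (`stub_fatBlock`, ∃-form `IC∃(ε)`) says: for some `ε > 0` and
all large `n`, SOME row-partitioned representation of `per_n` of minimal size `M` has a block of
size `≥ M / n^{1-ε}`.

This file places the bet between two exponential-regime statements.  From BELOW the line's
skeleton already shows (S2 + S4, landed) that S3 forces `r(n) ≥ exp(n^ε/ε − O(1))`.  From ABOVE we
prove here (`stub_fatBlock_of_grenetTight`): if Grenet's `2ⁿ − 1` is eventually the minimal size of
a row-partitioned representation (in particular if `dc(per_n) = 2ⁿ − 1` eventually,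
`fatBlock_of_dc_grenetTight`), then S3 holds for EVERY `ε < 1/2` — the witness is Grenet's own
representation (row-partitioned with the binomial profile, stub S5
`FatRowGrenet.stub_grenetRowPartitioned`), whose middle block has `C(n, ⌊n/2⌋) ≥ 2ⁿ/√(8n)`
elements (`four_pow_le_central_sq`, an elementary induction on the central binomial coefficient,
no Stirling).  Consequently the ∃-form of the bet cannot be refuted without refuting eventual
Grenet-optimality inside the row-partitioned class, and cannot be proved without an
`exp(n^ε)`-type lower bound: it is calibrated as exponential-regime on both sides.

* `four_pow_two_mul_le` — `4^(2m) ≤ 4·m·C(2m,m)²` (`m ≥ 1`).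
* `four_pow_le_central_sq` — `4ⁿ ≤ 8·n·C(n, ⌊n/2⌋)²` (`n ≥ 2`).
* `two_pow_le_rpow_mul_choose` — `2ⁿ ≤ n^{1-ε} · C(n, ⌊n/2⌋)` for `ε < 1/2` and `n` large.
* `stub_fatBlock_of_grenetTight` — the registered calibration stub (lead a1 reshape v3).
* `fatBlock_of_dc_grenetTight` — the same from eventual `2ⁿ − 1 ≤ dc(per_n)`.

Sources: B. Grenet (2011), Thm. 1 (key `Grenet2011`); J. M. Landsberg, N. Ressayre, ITCS 2016,
§2.2 (Grenet's representation and its optimality under symmetry).  Not here: the bet itself.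
-/

-- single-conjunct layout: Sub = Summit, duplicated namespace component intended
set_option linter.dupNamespace false

noncomputable section

namespace Summit.ValiantsHypothesis.ValiantsHypothesis.Theorems.DetQPDetqpThesis.FatRowCalibration

open MvPolynomial Finset
open Literature.Computability.AlgebraicComplexity

/-! ## The central binomial coefficient is at least `2ⁿ/√(8n)` (elementary) -/

/-- `4^(2m) ≤ 4·m·C(2m,m)²` for `m ≥ 1`: induction with
`(m+1)·C(2m+2,m+1) = 2(2m+1)·C(2m,m)` and `(2m+1)² ≥ 4m(m+1)`. [folklore] -/
theorem four_pow_two_mul_le {m : ℕ} (hm : 1 ≤ m) :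
    4 ^ (2 * m) ≤ 4 * m * Nat.centralBinom m ^ 2 := by
  induction m, hm using Nat.le_induction with
  | base => simp [Nat.centralBinom, Nat.choose]
  | succ m hm ih =>
    -- cancel the factor `m + 1`
    have hpos : 0 < m + 1 := Nat.succ_pos m
    refine Nat.le_of_mul_le_mul_left ?_ hpos
    have hrec : (m + 1) * Nat.centralBinom (m + 1) = 2 * (2 * m + 1) * Nat.centralBinom m :=
      Nat.succ_mul_centralBinom_succ m
    have key : (m + 1) * (4 * (m + 1) * Nat.centralBinom (m + 1) ^ 2) =
        16 * (2 * m + 1) ^ 2 * Nat.centralBinom m ^ 2 := by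
      have : (m + 1) * (4 * (m + 1) * Nat.centralBinom (m + 1) ^ 2) =
          4 * ((m + 1) * Nat.centralBinom (m + 1)) ^ 2 := by ring
      rw [this, hrec]; ring
    rw [key]
    have hsq : 4 * m * (m + 1) ≤ (2 * m + 1) ^ 2 := by nlinarith
    calc (m + 1) * 4 ^ (2 * (m + 1)) = 16 * ((m + 1) * 4 ^ (2 * m)) := by ring
      _ ≤ 16 * ((m + 1) * (4 * m * Nat.centralBinom m ^ 2)) := by gcongr
      _ = 16 * (4 * m * (m + 1)) * Nat.centralBinom m ^ 2 := by ring
      _ ≤ 16 * (2 * m + 1) ^ 2 * Nat.centralBinom m ^ 2 := by gcongr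

/-- `4ⁿ ≤ 8·n·C(n, ⌊n/2⌋)²` for `n ≥ 2` (even `n = 2m` from `four_pow_two_mul_le`; odd `n = 2m+1`
from `C(2m,m) ≤ C(2m+1,m)` and `4 ≤ 8`). [folklore] -/
theorem four_pow_le_central_sq {n : ℕ} (hn : 2 ≤ n) :
    4 ^ n ≤ 8 * n * n.choose (n / 2) ^ 2 := by
  obtain ⟨m, rfl | rfl⟩ := Nat.even_or_odd' n
  · -- even
    have hm : 1 ≤ m := by omega
    have h := four_pow_two_mul_le hm
    rw [Nat.centralBinom_eq_two_mul_choose] at h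
    have hdiv : 2 * m / 2 = m := by omega
    rw [hdiv]
    have h16 : 4 * m ≤ 8 * (2 * m) := by omega
    calc 4 ^ (2 * m) ≤ 4 * m * (2 * m).choose m ^ 2 := h
      _ ≤ 8 * (2 * m) * (2 * m).choose m ^ 2 := Nat.mul_le_mul_right _ h16
  · -- odd
    have hm : 1 ≤ m := by omega
    have h := four_pow_two_mul_le hm
    rw [Nat.centralBinom_eq_two_mul_choose] at h
    have hdiv : (2 * m + 1) / 2 = m := by omega
    rw [hdiv]
    have hmono : (2 * m).choose m ≤ (2 * m + 1).choose m := Nat.choose_le_choose m (by omega)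
    have h16 : 16 * m ≤ 8 * (2 * m + 1) := by omega
    calc 4 ^ (2 * m + 1) = 4 * 4 ^ (2 * m) := by ring
      _ ≤ 4 * (4 * m * (2 * m).choose m ^ 2) := by gcongr
      _ ≤ 4 * (4 * m * (2 * m + 1).choose m ^ 2) := by gcongr
      _ = 16 * m * (2 * m + 1).choose m ^ 2 := by ring
      _ ≤ 8 * (2 * m + 1) * (2 * m + 1).choose m ^ 2 := Nat.mul_le_mul_right _ h16

/-- For `ε < 1/2` and all large `n`: `2ⁿ ≤ n^{1-ε} · C(n, ⌊n/2⌋)` (from `4ⁿ ≤ 8n·C²` and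
`8 ≤ n^{1-2ε}` once `n ≥ 8^{1/(1-2ε)}`). [folklore] -/
theorem two_pow_le_rpow_mul_choose {ε : ℝ} (hε : ε < 1 / 2) :
    ∃ n₀ : ℕ, ∀ n ≥ n₀, (2 : ℝ) ^ n ≤ (n : ℝ) ^ (1 - ε) * (n.choose (n / 2) : ℝ) := by
  set t : ℝ := 1 - 2 * ε with ht_def
  have ht : 0 < t := by rw [ht_def]; linarith
  refine ⟨max 2 ⌈(8 : ℝ) ^ t⁻¹⌉₊, fun n hn => ?_⟩
  have hn2 : 2 ≤ n := le_trans (le_max_left _ _) hn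
  have hnceil : ⌈(8 : ℝ) ^ t⁻¹⌉₊ ≤ n := le_trans (le_max_right _ _) hn
  have hnR : (0 : ℝ) ≤ (n : ℝ) := Nat.cast_nonneg n
  -- `8 ≤ n ^ t`
  have h8 : (8 : ℝ) ≤ (n : ℝ) ^ t := by
    have hle : (8 : ℝ) ^ t⁻¹ ≤ (n : ℝ) := le_trans (Nat.le_ceil _) (by exact_mod_cast hnceil)
    have h0 : (0 : ℝ) ≤ (8 : ℝ) ^ t⁻¹ := Real.rpow_nonneg (by norm_num) _
    calc (8 : ℝ) = ((8 : ℝ) ^ t⁻¹) ^ t := (Real.rpow_inv_rpow (by norm_num) ht.ne').symm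
      _ ≤ (n : ℝ) ^ t := Real.rpow_le_rpow h0 hle ht.le
  -- the integer inequality, cast
  have hnat : ((4 : ℕ) ^ n : ℝ) ≤ ((8 * n * n.choose (n / 2) ^ 2 : ℕ) : ℝ) := by
    exact_mod_cast four_pow_le_central_sq hn2
  push_cast at hnat
  set C : ℝ := (n.choose (n / 2) : ℝ) with hC_def
  have hC : 0 ≤ C := Nat.cast_nonneg _
  have hpow : (0 : ℝ) ≤ (n : ℝ) ^ (1 - ε) := Real.rpow_nonneg hnR _
  -- compare squares
  have hsq : ((2 : ℝ) ^ n) ^ 2 ≤ ((n : ℝ) ^ (1 - ε) * C) ^ 2 := by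
    have h4 : ((2 : ℝ) ^ n) ^ 2 = (4 : ℝ) ^ n := by
      rw [← pow_mul, mul_comm, pow_mul]; norm_num
    have hrhs : ((n : ℝ) ^ (1 - ε) * C) ^ 2 = (n : ℝ) ^ t * (n : ℝ) * C ^ 2 := by
      have h2 : ((n : ℝ) ^ (1 - ε)) ^ 2 = (n : ℝ) ^ t * (n : ℝ) := by
        rw [← Real.rpow_two, ← Real.rpow_mul hnR]
        have h12 : (1 - ε) * 2 = t + 1 := by rw [ht_def]; ring
        rw [h12, Real.rpow_add' hnR (by linarith), Real.rpow_one]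
      rw [mul_pow, h2]
    rw [h4, hrhs]
    calc (4 : ℝ) ^ n ≤ 8 * (n : ℝ) * C ^ 2 := hnat
      _ ≤ (n : ℝ) ^ t * (n : ℝ) * C ^ 2 := by gcongr
  have hl : (0 : ℝ) ≤ (2 : ℝ) ^ n := by positivity
  have hr : (0 : ℝ) ≤ (n : ℝ) ^ (1 - ε) * C := mul_nonneg hpow hC
  exact (pow_le_pow_iff_left₀ hl hr two_ne_zero).mp hsq

/-! ## The sandwich from above: Grenet-tightness ⇒ the bet for every `ε < 1/2` -/

/-- **Registered calibration stub `stub_fatBlock_of_grenetTight` (lead a1, skeleton v3).**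
If, for all large `n`, `per_n` has NO row-partitioned affine determinantal representation of size
`< 2ⁿ − 1` (eventual Grenet-tightness inside the row-partitioned class), then for EVERY `ε < 1/2`
and all large `n` some minimal row-partitioned representation of `per_n` — namely Grenet's, of size
`M = 2ⁿ − 1`, row-partitioned with block `c` of size `C(n,c)` (`FatRowGrenet.stub_grenetRowPartitioned`)
— has a block (`c = ⌊n/2⌋`) of size `≥ M / n^{1-ε}` (`two_pow_le_rpow_mul_choose`).  This is the
matrix of the bet `stub_fatBlock` with `ε` universally quantified below `1/2`: the ∃-form of the bet
is implied by eventual Grenet-optimality, hence irrefutable short of refuting the latter.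
[cite: Grenet2011, Thm. 1] -/
theorem stub_fatBlock_of_grenetTight :
    (∃ n₁ : ℕ, ∀ n ≥ n₁, ∀ M < 2 ^ n - 1,
        ¬ ∃ (A : Matrix (Fin M) (Fin M) (MvPolynomial (Fin n × Fin n) ℂ)) (β : Fin M → Fin n),
          IsAffineDetRepr (perPoly (Fin n) ℂ) A ∧
          ∀ a b (e : Fin n × Fin n), coeff (Finsupp.single e 1) (A a b) ≠ 0 → e.2 = β a) →
    ∀ ε : ℝ, ε < 1 / 2 → ∃ n₀ : ℕ, ∀ n ≥ n₀,
      ∃ (M : ℕ) (A : Matrix (Fin M) (Fin M) (MvPolynomial (Fin n × Fin n) ℂ)) (β : Fin M → Fin n),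
        IsAffineDetRepr (perPoly (Fin n) ℂ) A ∧
        (∀ a b (e : Fin n × Fin n), coeff (Finsupp.single e 1) (A a b) ≠ 0 → e.2 = β a) ∧
        (∀ M' < M, ¬ ∃ (A' : Matrix (Fin M') (Fin M') (MvPolynomial (Fin n × Fin n) ℂ))
            (β' : Fin M' → Fin n),
            IsAffineDetRepr (perPoly (Fin n) ℂ) A' ∧
            ∀ a b (e : Fin n × Fin n), coeff (Finsupp.single e 1) (A' a b) ≠ 0 → e.2 = β' a) ∧
        ∃ j : Fin n, (M : ℝ) ≤ (n : ℝ) ^ (1 - ε) * ((Finset.univ.filter fun a => β a = j).card : ℝ) := by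
  rintro ⟨n₁, htight⟩ ε hε
  obtain ⟨n₂, hchoose⟩ := two_pow_le_rpow_mul_choose hε
  refine ⟨max (max n₁ n₂) 1, fun n hn => ?_⟩
  have hn₁ : n₁ ≤ n := le_trans (le_trans (le_max_left _ _) (le_max_left _ _)) hn
  have hn₂ : n₂ ≤ n := le_trans (le_trans (le_max_right _ _) (le_max_left _ _)) hn
  have hn1 : 1 ≤ n := le_trans (le_max_right _ _) hn
  obtain ⟨A, β, hA, hβ, hprof⟩ := FatRowGrenet.stub_grenetRowPartitioned n hn1
  refine ⟨2 ^ n - 1, A, β, hA, hβ, fun M' hM' => htight n hn₁ M' hM', ⟨n / 2, by omega⟩, ?_⟩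
  rw [hprof ⟨n / 2, by omega⟩]
  have hcast : ((2 ^ n - 1 : ℕ) : ℝ) ≤ (2 : ℝ) ^ n := by
    have h : ((2 ^ n - 1 : ℕ) : ℝ) ≤ ((2 ^ n : ℕ) : ℝ) := by exact_mod_cast Nat.sub_le _ _
    rwa [Nat.cast_pow, Nat.cast_ofNat] at h
  exact hcast.trans (hchoose n hn₂)

/-- **Eventual Grenet dc-optimality ⇒ the bet for every `ε < 1/2`.**  If `2ⁿ − 1 ≤ dc(per_n)` for
all large `n` (Grenet's upper bound is eventually tight — the `GrenetRigidity` scenario, also the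
hypothesis of `Negative.detqpThesis_of_eventually_grenet_tight`), then no row-partitioned
representation of size `< 2ⁿ − 1` exists (it would be a representation), so
`stub_fatBlock_of_grenetTight` applies. [cite: Grenet2011, Thm. 1] -/
theorem fatBlock_of_dc_grenetTight
    (h : ∃ n₁ : ℕ, ∀ n ≥ n₁, 2 ^ n - 1 ≤ determinantalComplexity (perPoly (Fin n) ℂ)) :
    ∀ ε : ℝ, ε < 1 / 2 → ∃ n₀ : ℕ, ∀ n ≥ n₀,
      ∃ (M : ℕ) (A : Matrix (Fin M) (Fin M) (MvPolynomial (Fin n × Fin n) ℂ)) (β : Fin M → Fin n),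
        IsAffineDetRepr (perPoly (Fin n) ℂ) A ∧
        (∀ a b (e : Fin n × Fin n), coeff (Finsupp.single e 1) (A a b) ≠ 0 → e.2 = β a) ∧
        (∀ M' < M, ¬ ∃ (A' : Matrix (Fin M') (Fin M') (MvPolynomial (Fin n × Fin n) ℂ))
            (β' : Fin M' → Fin n),
            IsAffineDetRepr (perPoly (Fin n) ℂ) A' ∧
            ∀ a b (e : Fin n × Fin n), coeff (Finsupp.single e 1) (A' a b) ≠ 0 → e.2 = β' a) ∧
        ∃ j : Fin n, (M : ℝ) ≤ (n : ℝ) ^ (1 - ε) * ((Finset.univ.filter fun a => β a = j).card : ℝ) := by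
  obtain ⟨n₁, hdc⟩ := h
  refine stub_fatBlock_of_grenetTight ⟨n₁, fun n hn M hM => ?_⟩
  rintro ⟨A', β', hA', -⟩
  have hle : determinantalComplexity (perPoly (Fin n) ℂ) ≤ M :=
    determinantalComplexity_le_of_hasDetRepr ⟨A', hA'⟩
  have := hdc n hn
  omega

end Summit.ValiantsHypothesis.ValiantsHypothesis.Theorems.DetQPDetqpThesis.FatRowCalibration

end
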